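import Mathlib
import Literature.RingTheory.Multisymmetric.LowDegreeFreeness

/-!
# Rank of the elementary multisymmetric monomials of a given content: at least the number of
# vector partitions with at most `n` parts

Continuation of `Literature/RingTheory/Multisymmetric/LowDegreeFreeness.lean` (notation: `n` vectors
with coordinates `ι`, `e_α = elemMultisymm ι n α`, elementary monomials `elemProd ι n s` of vector
partitions `s`, content `vpContent s`).  A VECTOR PARTITION of the content `α : ι →₀ ℕ` is a
multiplicity function `s` on nonzero multi-exponents with `∑ (s β) • β = α` (`IsVectorPartition`); there
are finitely many (`isVectorPartition_finite`); write `p(α)` for their number and `p_{≤ n}(α)`,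
`p_{> n}(α)` for those with at most / more than `n` parts.

**Theorem** (`finrank_le_card_of_aeval_elemMultisymm_eq_zero`, characteristic zero).  A `k`-linear space
`W` of polynomials in the symbols `Z_β` whose monomials are vector partitions of `α` and which VANISH at
`Z_β = e_β(t_1, …, t_n)` has dimension at most `p_{> n}(α)`.  Equivalently: the elementary monomials of
content `α` span a space of dimension `≥ p_{≤ n}(α)` (`card_le_finrank_elemSpan`), because it contains
the `p_{≤ n}(α)` linearly independent power-sum monomials with at most `n` parts
(`powerSumProd_linearIndependent`, `powerSumProd_mem_elemSpan`).  For `|α| ≤ n` every vector partition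
has at most `n` parts and the statement is the low-degree freeness `W = 0`.  (By Weyl's theorem the
rank is exactly `p_{≤ n}(α)` = the number of orbit sums of monomials of content `α` in `n` vectors; only
the inequality is proved and needed.)

References: P. A. MacMahon, *Combinatory Analysis* II §XI (multipartite partitions); J. Dalbec,
Beiträge Algebra Geom. 40 (1999) §2; F. Vaccarino, Ann. Inst. Fourier 55 (2005) Thm. 1.
-/

noncomputable section

open MvPolynomial

namespace Literature.RingTheory.Multisymmetric

variable {k : Type*} [Field k] {ι : Type*} [Fintype ι] [DecidableEq ι] (n : ℕ)

variable {n}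

/-- `s` is a VECTOR PARTITION of the content `α`: nonzero parts and `∑ (s β) • β = α`. [folklore] -/
def IsVectorPartition (α : ι →₀ ℕ) (s : (ι →₀ ℕ) →₀ ℕ) : Prop :=
  (∀ β ∈ s.support, β ≠ 0) ∧ vpContent s = α

omit [DecidableEq ι] in
/-- There are finitely many vector partitions of a given content. [folklore] -/
theorem isVectorPartition_finite (α : ι →₀ ℕ) : {s : (ι →₀ ℕ) →₀ ℕ | IsVectorPartition α s}.Finite :=
  Set.Finite.subset (vpAdmissible_finite α.degree) fun _ hs => ⟨hs.1, hs.2 ▸ le_rfl⟩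

/-- The finite type of vector partitions of `α`. [folklore] -/
instance isVectorPartition.finite (α : ι →₀ ℕ) : Finite {s : (ι →₀ ℕ) →₀ ℕ // IsVectorPartition α s} :=
  (isVectorPartition_finite α).to_subtype

/-- The finite type of vector partitions of `α` with a side condition. [folklore] -/
instance isVectorPartition.finite' (α : ι →₀ ℕ) (P : ((ι →₀ ℕ) →₀ ℕ) → Prop) :
    Finite {s : (ι →₀ ℕ) →₀ ℕ // IsVectorPartition α s ∧ P s} :=
  Finite.of_injective (fun s => (⟨s.1, s.2.1⟩ : {s : (ι →₀ ℕ) →₀ ℕ // IsVectorPartition α s}))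
    fun _ _ h => Subtype.ext
      (congrArg (fun x : {s : (ι →₀ ℕ) →₀ ℕ // IsVectorPartition α s} => x.1) h)

omit [DecidableEq ι] in
/-- `p(α) = p_{≤ n}(α) + p_{> n}(α)`. [folklore] -/
theorem card_isVectorPartition_eq_add (α : ι →₀ ℕ) (n : ℕ) :
    Nat.card {s : (ι →₀ ℕ) →₀ ℕ // IsVectorPartition α s} =
      Nat.card {s : (ι →₀ ℕ) →₀ ℕ // IsVectorPartition α s ∧ s.degree ≤ n} +
        Nat.card {s : (ι →₀ ℕ) →₀ ℕ // IsVectorPartition α s ∧ n < s.degree} := by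
  classical
  rw [Nat.card_congr (Equiv.subtypeSubtypeEquivSubtypeInter (IsVectorPartition α)
      (fun s : (ι →₀ ℕ) →₀ ℕ => s.degree ≤ n)).symm,
    Nat.card_congr (Equiv.subtypeSubtypeEquivSubtypeInter (IsVectorPartition α)
      (fun s : (ι →₀ ℕ) →₀ ℕ => n < s.degree)).symm,
    Nat.card_congr (Equiv.sumCompl (fun s : {s : (ι →₀ ℕ) →₀ ℕ // IsVectorPartition α s} =>
      s.1.degree ≤ n)).symm, Nat.card_sum]
  congr 1
  exact Nat.card_congr (Equiv.subtypeEquivRight fun s => not_le)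

variable (ι n)

/-- **The elementary monomials of content `α` span a space of dimension at least `p_{≤ n}(α)`**, the
number of vector partitions of `α` with at most `n` parts (characteristic zero). [folklore] -/
theorem card_le_finrank_elemSpan [CharZero k] (α : ι →₀ ℕ) :
    Nat.card {s : (ι →₀ ℕ) →₀ ℕ // IsVectorPartition α s ∧ s.degree ≤ n} ≤
      Module.finrank k (elemSpan (k := k) ι n α) := by
  classical
  haveI : Fintype {s : (ι →₀ ℕ) →₀ ℕ // IsVectorPartition α s ∧ s.degree ≤ n} := Fintype.ofFinite _
  set P : {s : (ι →₀ ℕ) →₀ ℕ // IsVectorPartition α s ∧ s.degree ≤ n} → MvPolynomial (ι × Fin n) k :=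
    fun s => powerSumProd ι n s.1 with hP
  have hPind : LinearIndependent k P := by
    let f : {s : (ι →₀ ℕ) →₀ ℕ // IsVectorPartition α s ∧ s.degree ≤ n} →
        {s : (ι →₀ ℕ) →₀ ℕ // (∀ β ∈ s.support, β ≠ 0) ∧ s.degree ≤ n} :=
      fun s => ⟨s.1, s.2.1.1, s.2.2⟩
    have hf : Function.Injective f := fun s t h => Subtype.ext (congrArg (fun x => x.1) h)
    exact (powerSumProd_linearIndependent (k := k) ι n).comp f hf
  have hle : Submodule.span k (Set.range P) ≤ elemSpan (k := k) ι n α := by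
    rw [Submodule.span_le]
    rintro _ ⟨s, rfl⟩
    have h := powerSumProd_mem_elemSpan (k := k) (ι := ι) (n := n) s.1
    rw [s.2.1.2] at h
    exact h
  haveI : FiniteDimensional k (elemSpan (k := k) ι n α) := by
    haveI : Fintype {s : (ι →₀ ℕ) →₀ ℕ // IsVectorPartition α s} := Fintype.ofFinite _
    have hspan : elemSpan (k := k) ι n α = Submodule.span k (Set.range
        fun s : {s : (ι →₀ ℕ) →₀ ℕ // IsVectorPartition α s} => elemProd (k := k) ι n s.1) := by
      apply le_antisymm
      · refine Submodule.span_mono ?_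
        rintro _ ⟨s, hs, hsα, rfl⟩
        exact ⟨⟨s, hs, hsα⟩, rfl⟩
      · refine Submodule.span_mono ?_
        rintro _ ⟨s, rfl⟩
        exact ⟨s.1, s.2.1, s.2.2, rfl⟩
    rw [hspan]
    exact FiniteDimensional.span_of_finite k (Set.finite_range _)
  rw [Nat.card_eq_fintype_card, ← finrank_span_eq_card hPind]
  exact Submodule.finrank_mono hle

/-- **Polynomial relations among the `e_β` of a given content are few**: a `k`-linear space of
polynomials in the symbols `Z_β`, all of whose monomials are vector partitions of `α`, which vanish at
`Z_β = e_β(t_1, …, t_n)`, has dimension at most `p_{> n}(α)`, the number of vector partitions of `α` with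
MORE than `n` parts (characteristic zero).  For `|α| ≤ n` this is `0` (low-degree freeness).
[folklore] -/
theorem finrank_le_card_of_aeval_elemMultisymm_eq_zero [CharZero k] (α : ι →₀ ℕ)
    (W : Submodule k (MvPolynomial (ι →₀ ℕ) k))
    (hsupp : ∀ Q ∈ W, ∀ s ∈ Q.support, IsVectorPartition α s)
    (hker : ∀ Q ∈ W, aeval (elemMultisymm (k := k) ι n) Q = 0) :
    Module.finrank k W ≤ Nat.card {s : (ι →₀ ℕ) →₀ ℕ // IsVectorPartition α s ∧ n < s.degree} := by
  classical
  haveI : Fintype {s : (ι →₀ ℕ) →₀ ℕ // IsVectorPartition α s} := Fintype.ofFinite _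
  -- the space of all polynomials supported on vector partitions of `α`
  set b : {s : (ι →₀ ℕ) →₀ ℕ // IsVectorPartition α s} → MvPolynomial (ι →₀ ℕ) k :=
    fun s => monomial s.1 (1 : k) with hb
  set V : Submodule k (MvPolynomial (ι →₀ ℕ) k) := Submodule.span k (Set.range b) with hV
  have hbind : LinearIndependent k b := by
    have h := (basisMonomials (ι →₀ ℕ) k).linearIndependent
    rw [coe_basisMonomials] at h
    exact h.comp (fun s : {s : (ι →₀ ℕ) →₀ ℕ // IsVectorPartition α s} => s.1) Subtype.val_injective
  have hVdim : Module.finrank k V = Fintype.card {s : (ι →₀ ℕ) →₀ ℕ // IsVectorPartition α s} :=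
    finrank_span_eq_card hbind
  haveI : FiniteDimensional k V := FiniteDimensional.span_of_finite k (Set.finite_range b)
  have hWV : W ≤ V := by
    intro Q hQ
    rw [← support_sum_monomial_coeff Q]
    refine Submodule.sum_mem _ fun s hs => ?_
    rw [← mul_one (coeff s Q), ← smul_eq_mul, ← smul_monomial]
    exact Submodule.smul_mem _ _ (Submodule.subset_span ⟨⟨s, hsupp Q hQ s hs⟩, rfl⟩)
  -- evaluation at the elementary multisymmetric polynomials, restricted to `V`
  set ev : V →ₗ[k] MvPolynomial (ι × Fin n) k :=
    (aeval (elemMultisymm (k := k) ι n)).toLinearMap.domRestrict V with hev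
  have hrn := LinearMap.finrank_range_add_finrank_ker ev
  -- the range contains `elemSpan α`, of dimension `≥ p_{≤ n}(α)`
  have hrange : elemSpan (k := k) ι n α ≤ LinearMap.range ev := by
    rw [elemSpan, Submodule.span_le]
    rintro _ ⟨s, hs, hsα, rfl⟩
    refine ⟨⟨monomial s (1 : k), Submodule.subset_span ⟨⟨s, hs, hsα⟩, rfl⟩⟩, ?_⟩
    rw [hev, LinearMap.domRestrict_apply, AlgHom.toLinearMap_apply, aeval_monomial, map_one, one_mul]
    rfl
  haveI : FiniteDimensional k (LinearMap.range ev) := LinearMap.finiteDimensional_range ev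
  have h1 : Nat.card {s : (ι →₀ ℕ) →₀ ℕ // IsVectorPartition α s ∧ s.degree ≤ n} ≤
      Module.finrank k (LinearMap.range ev) :=
    (card_le_finrank_elemSpan (k := k) ι n α).trans (Submodule.finrank_mono hrange)
  -- `W` sits inside the kernel
  have h2 : Module.finrank k W ≤ Module.finrank k (LinearMap.ker ev) := by
    have hle : Submodule.comap V.subtype W ≤ LinearMap.ker ev := by
      intro x hx
      rw [LinearMap.mem_ker, hev, LinearMap.domRestrict_apply, AlgHom.toLinearMap_apply]
      exact hker _ hx
    rw [← LinearEquiv.finrank_eq (Submodule.comapSubtypeEquivOfLe hWV)]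
    exact Submodule.finrank_mono hle
  have h3 := card_isVectorPartition_eq_add α n
  rw [Nat.card_eq_fintype_card] at h3
  omega

end Literature.RingTheory.Multisymmetric
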